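import Summits.BirchSwinnertonDyer.BirchSwinnertonDyer.Theorems.GenusKolyvaginAtTwoPowDvdShaCardAtTwoRTPrimeSwappingWeak
import HarnessLib

/-!
# Route `GenusKolyvaginAtTwo`, crux L_T `PowDvdShaCardAtTwoRT` (stmt-BirchSwinnertonDyer-23242), LINE 18 stub L, step (b):
# the prime-swapping loop over the weak oracle — THE LEVEL IS EXPORTED

Seat `bsd-line-gk2-p2` g18 (PROVER seat 2/3, cell `bsd-f1-sign2`), `--supports stmt-BirchSwinnertonDyer-23242` (helper; closes
nothing). Mathlib-only algebra; THEOREMS ONLY (no definition, no named fact, no `sorry`); BSD is not proved by any of this.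

WHY. The engine-facing interface of stub L (`twinShaLadders_of_prop52DivAtTwo`, file `…RTTwinShaLaddersOfProp52Div`, hypothesis
(P52÷)) asks, for every `≤ r`-generated `⟨u⟩ ⊂ Sel_{2^L}(E/K)^{ε_r}`, for a deep square-free LEVEL `n` of depth `r` whose class
`c_L(n)` meets `⟨u⟩` trivially (with `2^{M_r} ∥ P(n)`).  The loop theorem of `…RTPrimeSwappingWeak` (g16),
`exists_avoiding_of_weakSwapOracle(_pow)`, exports only an anonymous `z ∈ R` — although its proof produces `z = cls S` for an
admissible all-good prime set `S`.  This file re-exports the SAME loop with the level visible: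
`exists_level_avoiding_of_weakSwapOracle(_pow)` conclude `∃ S, Inv S ∧ (∀ l ∈ S, good l) ∧ ⟨cls S⟩ ∩ ⟨s⟩ = 0`, so that the
instantiation `cls S := c_L(∏ S)`, `Inv S := «S ⊆ S(L), #S = r, 2^{M_r} ∥ P_{∏S}»` yields the (P52÷) witness `(n, d) := (∏ S, d_S)`
directly.  Proofs: `exists_good_not_mem_of_weakSwapOracle` (the loop, exported `S`) + `disjoint_zmultiples_of_socle_not_mem`.

References: [McCallumLMS1991] §5 Prop. 5.2 (proof pp. 308–310), §4 Lemma 4.6.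
-/

-- `Summit.<P>.<Sub>` repeats `BirchSwinnertonDyer` by the tree's layout convention (D-0017)
set_option linter.dupNamespace false

namespace Summit.BirchSwinnertonDyer.BirchSwinnertonDyer.Theorems.GenusExact.PlusDescent

open AddSubgroup Finset

variable {V : Type*} [AddCommGroup V]

/-- **One rung of the supply WITH ITS LEVEL** (McCallum Prop. 5.2 over the weak oracle): `V` is `p^M`-torsion, `R ≤ V` finite
(the relaxed Selmer group) containing the avoided set `s` (`#s ≤ r`), `A l` the strict local conditions of index `∣ p` on `⟨s⟩[p]`
at good primes, `Inv` the admissibility invariant on `r`-sets with an admissible start; for an admissible all-good `S` the ladder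
class `cls S` lies in every `A l`, `l ∈ S`, and the detected class `γ S ∈ ⟨cls S⟩` is non-zero and killed by `p`; weak oracle.
THEN some admissible all-good `S` has `⟨cls S⟩ ∩ ⟨s⟩ = 0`. [cite: McCallumLMS1991, §5 Prop. 5.2 (proof, pp. 308–310); §4 Lemma 4.6] -/
theorem exists_level_avoiding_of_weakSwapOracle {p : ℕ} (hp : p.Prime) {M : ℕ} (hV : ∀ v : V, p ^ M • v = 0)
    (R : AddSubgroup V) [Finite R] (A : ℕ → AddSubgroup V) (good : ℕ → Prop) (r : ℕ) (Inv : Finset ℕ → Prop)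
    (hcardS : ∀ S, Inv S → S.card = r)
    (hK : ∀ l, good l → ∀ s : Finset V, (↑s : Set V) ⊆ R →
      (A l).relIndex (AddSubgroup.closure (↑s : Set V) ⊓ AddSubgroup.torsionBy V (p : ℤ)) ∣ p)
    (S₀ : Finset ℕ) (hS₀ : Inv S₀)
    (cls γ : Finset ℕ → V)
    (hcls : ∀ S, Inv S → (∀ l ∈ S, good l) →
      (∀ l ∈ S, cls S ∈ A l) ∧ γ S ∈ AddSubgroup.zmultiples (cls S) ∧ γ S ≠ 0 ∧ p • γ S = 0)
    (oracle : ∀ S, Inv S → ∀ l₀ ∈ S, ∃ l', l' ∉ S ∧ good l' ∧ Inv (insert l' (S.erase l₀)) ∧ γ S ∉ A l')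
    (s : Finset V) (hs : (↑s : Set V) ⊆ R) (hsr : s.card ≤ r) :
    ∃ S, Inv S ∧ (∀ l ∈ S, good l) ∧ Disjoint (AddSubgroup.zmultiples (cls S)) (AddSubgroup.closure (↑s : Set V)) := by
  classical
  set C : AddSubgroup V := AddSubgroup.closure (↑s : Set V) with hC
  have hCR : C ≤ R := (AddSubgroup.closure_le R).mpr hs
  haveI : Finite C := Finite.of_injective _ (AddSubgroup.inclusion_injective hCR)
  -- the rank of `C`: `#C[p] = p^d`, `d ≤ #s ≤ r`
  obtain ⟨d, hd, hcard⟩ := exists_natCard_closure_inf_torsionBy_eq_pow (V := V) hp R s hs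
  -- the detected class lies in every `A l` because the ladder class does
  have hγ : ∀ S, Inv S → (∀ l ∈ S, good l) → γ S ≠ 0 ∧ p • γ S = 0 ∧ ∀ l ∈ S, γ S ∈ A l := by
    intro S hS hgood
    obtain ⟨hA, hγz, hγ0, hγp⟩ := hcls S hS hgood
    refine ⟨hγ0, hγp, fun l hl ↦ ?_⟩
    exact AddSubgroup.zmultiples_le_of_mem (hA l hl) hγz
  obtain ⟨S, hS, hgood, hγC⟩ := exists_good_not_mem_of_weakSwapOracle hp C hcard (hd.trans hsr) A good Inv hcardS
    (fun l hl ↦ hK l hl s hs) γ hγ S₀ hS₀ oracle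
  obtain ⟨-, hγz, -, hγp⟩ := hcls S hS hgood
  exact ⟨S, hS, hgood, disjoint_zmultiples_of_socle_not_mem hp hV C hγz hγp hγC⟩

/-- **One rung of the supply WITH ITS LEVEL, socle form**: as `exists_level_avoiding_of_weakSwapOracle` with the detected class
`γ S := p^(e S − 1) · cls S`, `ord (cls S) = p^(e S)`, `1 ≤ e S` (McCallum: `cls S = c_{M_{r−1}}(n_S)`, `e S = M_{r−1} − M_r`,
detected class `c_{M_r+1}(n_S)`, Lemma 4.6). [cite: McCallumLMS1991, §5 Prop. 5.2, §4 Lemma 4.6] -/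
theorem exists_level_avoiding_of_weakSwapOracle_pow {p : ℕ} (hp : p.Prime) {M : ℕ} (hV : ∀ v : V, p ^ M • v = 0)
    (R : AddSubgroup V) [Finite R] (A : ℕ → AddSubgroup V) (good : ℕ → Prop) (r : ℕ) (Inv : Finset ℕ → Prop)
    (hcardS : ∀ S, Inv S → S.card = r)
    (hK : ∀ l, good l → ∀ s : Finset V, (↑s : Set V) ⊆ R →
      (A l).relIndex (AddSubgroup.closure (↑s : Set V) ⊓ AddSubgroup.torsionBy V (p : ℤ)) ∣ p)
    (S₀ : Finset ℕ) (hS₀ : Inv S₀)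
    (cls : Finset ℕ → V) (e : Finset ℕ → ℕ)
    (hcls : ∀ S, Inv S → (∀ l ∈ S, good l) → addOrderOf (cls S) = p ^ e S ∧ 1 ≤ e S ∧ ∀ l ∈ S, cls S ∈ A l)
    (oracle : ∀ S, Inv S → ∀ l₀ ∈ S,
      ∃ l', l' ∉ S ∧ good l' ∧ Inv (insert l' (S.erase l₀)) ∧ p ^ (e S - 1) • cls S ∉ A l')
    (s : Finset V) (hs : (↑s : Set V) ⊆ R) (hsr : s.card ≤ r) :
    ∃ S, Inv S ∧ (∀ l ∈ S, good l) ∧ Disjoint (AddSubgroup.zmultiples (cls S)) (AddSubgroup.closure (↑s : Set V)) := by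
  refine exists_level_avoiding_of_weakSwapOracle hp hV R A good r Inv hcardS hK S₀ hS₀ cls
    (fun S ↦ p ^ (e S - 1) • cls S) (fun S hS hgood ↦ ?_) oracle s hs hsr
  obtain ⟨hord, he, hA⟩ := hcls S hS hgood
  obtain ⟨h0, hp0, hmem⟩ := pow_pred_nsmul_socle he hord hp
  exact ⟨hA, hmem, h0, hp0⟩

end Summit.BirchSwinnertonDyer.BirchSwinnertonDyer.Theorems.GenusExact.PlusDescent
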